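import Summits.CriticalPhenomena.PercolationContinuityZ3.Theorems.PercLowPointHalfSpaceBoundaryTwoArmDecayKTailAtReduction

/-!
# Crux `PercLowPointHalfSpace.BoundaryTwoArmDecay` (stmt-CriticalPhenomena-0911), line
# `staircase-bootstrap-floor-decoupling` (lead c1): the FULLY PARAMETRIC reduction — one blocking exponent `t`,
# one multiplicity loss `c`, one slab exponent `A`, with `5A + 4c + 2t < 6`

`…KTailReduction.lean` (p140944) and `…KTailAtReduction.lean` (p141852) reduce crux A to a multiplicity input (KTail, or KTailAt `c`),
a slab input (`SlabCrossover A`) and the sibling crux `SubpolynomialBlocking` (stmt-4446: the annulus-blocking probability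
`u_m = P(no open path inside B(2m) from B(m) to ∂⁻B(2m))` is eventually `≥ m^{-s}` for EVERY `s > 0`).  The blocking input is used only
through the tall density `ν_n ≤ C n^{s-2}`, i.e. only AT ONE exponent.  This file records the resulting three-parameter corner as a
registered sub-goal of the crux item (`stub_kTailAtBlockingAtReduction`, `--supports stmt-CriticalPhenomena-0911`):

  `0 < c → 0 < t → 1 ≤ A → 5A + 4c + 2t < 6 → KTailAt c → BlockingAt t → SlabCrossover A → BoundaryTwoArmDecay`,

* `KTailAt c`   : eventually `n^{-c} P(A_n) ≤ P(A_n ∧ K_n ≤ ⌈n^c⌉)` (partner-kiss multiplicity at a FIXED polynomial loss);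
* `BlockingAt t`: eventually `n^{-t} ≤ u_n` (annulus blocking at a FIXED polynomial rate — stmt-4446 is `∀ t > 0, BlockingAt t`);
* `SlabCrossover A`: the body of stmt-6700 at the exponent `A`.

So every one of the three open inputs of the line may be taken at a single exponent, the only coupling being the linear budget
`5A + 4c + 2t < 6` (physical corner `A = 1`: any `4c + 2t < 1`).

Notation: `A_n = StubStep.kissV n 0 1` (both `ℍ`-clusters of the adjacent floor roots `0, e` meet level `n`, distinct),
`K_n = (StubStep.partnerKiss n ω).ncard`, `e_n = StubStep.exactDens n`, `ν_n = StubStep.tallDens n`.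

## Proof

* `StubTallDensity.density_bound_of_blockingAt`: the landed one-annulus estimate `ν_n ≤ 1/(u_m (2m+1)²)` (`StubTallDensity.density_le`,
  p131461: translation invariance on the floor patch, disjoint tall clusters are disjoint crossings, BK–Reimer, geometric series) with
  `m = ⌊(n-1)/2⌋` and `u_m ≥ m^{-t}` gives `ν_n ≤ C n^{t-2}` for all `n ≥ 1` — the proof of `stub_tallDensity` run at the single exponent `t`.
* `StubDirectStep.aprioriV_of_kTailAt_at`: KTailAt `c` + the census at `k = ⌈n^c⌉` (`StubDirectStep.pointwise`, p140944) + dyadic averaging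
  with the tall density at `t` (`StubStep.even_bound`, `sum_exactDens_toReal_le`, `decay_of_eventually`): vertical exponent `a = 3 - 2c - t`.
* Reach (`stub_reach`, p130902) with `δ := 6 - 5A - 4c - 2t > 0`, `b = 5/2 + δ/4`: `b·A < a ⟺ A < 2`, true since `5A < 6`; `κ = δ/4`.
-/

noncomputable section

namespace Summit.CriticalPhenomena.PercolationContinuityZ3.Theorems.BoundaryTwoArmDecay

open MeasureTheory
open scoped ENNReal
open Literature.Probability.Percolation Literature.Probability.LatticeModels

namespace StubTallDensity

/-- **Tall density from blocking at ONE exponent.** If the annulus-blocking probability satisfies `u_m ≥ m^{-t}` eventually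
(for this one `t > 0`), then `ν_n ≤ C n^{t-2}` for all `n ≥ 1` — the proof of the landed `stub_tallDensity` (p131461) at the single
exponent `t` (adapted verbatim; the engine is `density_le`: `ν_n ≤ 1/(u_m (2m+1)²)` for `2m + 1 ≤ n`). -/
theorem density_bound_of_blockingAt {t : ℝ} (ht : 0 < t)
    (hB : ∀ᶠ n : ℕ in Filter.atTop, (n : ℝ) ^ (-t) ≤ (bondPercolation (zdGraph 3) (criticalProbI 3)).real
      {ω | ¬ ∃ x ∈ box 3 n, ∃ y ∈ innerBoundary (zdGraph 3) (box 3 (2 * n)), ω ∈ openConnIn ↑(box 3 (2 * n)) x y}) :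
    ∃ C : ℝ, ∀ n : ℕ, 1 ≤ n →
      (∫⁻ ω, {ω | ∃ y : Site 3, (n : ℤ) ≤ y 0 ∧ ω ∈ openConnIn (halfSpace 3) 0 y}.indicator
          (fun ω => (((halfSpaceFootprint ω : ℕ∞) : ENNReal))⁻¹) ω
          ∂(bondPercolation (zdGraph 3) (criticalProbI 3))) ≤
        ENNReal.ofReal (C * (n : ℝ) ^ (t - 2)) := by
  obtain ⟨N₀, hN₀⟩ := Filter.eventually_atTop.1 hB
  set N₁ : ℕ := 2 * N₀ + 3 with hN₁
  refine ⟨4 + (N₁ : ℝ) ^ 2, fun n hn => ?_⟩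
  have hn1 : (1 : ℝ) ≤ n := by exact_mod_cast hn
  have hnpos : (0 : ℝ) < n := by linarith
  -- `n^{t-2} = n^t / n^2 ≥ 1 / n^2`
  have hsplit : (n : ℝ) ^ (t - 2) = (n : ℝ) ^ t / (n : ℝ) ^ 2 := by
    rw [Real.rpow_sub hnpos, Real.rpow_two]
  have hns : (1 : ℝ) ≤ (n : ℝ) ^ t := Real.one_le_rpow hn1 ht.le
  by_cases hsmall : n < N₁
  · -- small `n`: `ν_n ≤ 1 ≤ N₁² / n² ≤ C n^{t-2}`
    refine (density_le_one n).trans ?_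
    rw [← ENNReal.ofReal_one]
    refine ENNReal.ofReal_le_ofReal ?_
    rw [hsplit]
    have hnN : (n : ℝ) ≤ N₁ := by exact_mod_cast hsmall.le
    have hn2 : (n : ℝ) ^ 2 ≤ (N₁ : ℝ) ^ 2 := pow_le_pow_left₀ hnpos.le hnN 2
    have hn2pos : (0 : ℝ) < (n : ℝ) ^ 2 := by positivity
    have hq : (1 : ℝ) / (n : ℝ) ^ 2 ≤ (n : ℝ) ^ t / (n : ℝ) ^ 2 := div_le_div_of_nonneg_right hns hn2pos.le
    have h1q : (1 : ℝ) ≤ (N₁ : ℝ) ^ 2 * (1 / (n : ℝ) ^ 2) := by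
      rw [mul_one_div, le_div_iff₀ hn2pos, one_mul]
      exact hn2
    calc (1 : ℝ) ≤ (N₁ : ℝ) ^ 2 * (1 / (n : ℝ) ^ 2) := h1q
      _ ≤ (4 + (N₁ : ℝ) ^ 2) * ((n : ℝ) ^ t / (n : ℝ) ^ 2) :=
          mul_le_mul (by linarith) hq (by positivity) (by positivity)
  · -- large `n`: `m = ⌊(n-1)/2⌋ ≥ N₀`, `2m+1 ≤ n ≤ 2m+2`
    push Not at hsmall
    set m : ℕ := (n - 1) / 2 with hm
    have hmN : N₀ ≤ m := by omega
    have hm1 : 1 ≤ m := by omega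
    have hmn : 2 * m + 1 ≤ n := by omega
    have hnm : n ≤ 2 * m + 2 := by omega
    have hu := hN₀ m hmN
    have hmpos : (0 : ℝ) < m := by exact_mod_cast hm1
    have hms : (0 : ℝ) < (m : ℝ) ^ (-t) := Real.rpow_pos_of_pos hmpos _
    have hupos : 0 < (bondPercolation (zdGraph 3) (criticalProbI 3)).real
        {ω | ¬ ∃ x ∈ box 3 m, ∃ y ∈ innerBoundary (zdGraph 3) (box 3 (2 * m)),
          ω ∈ openConnIn ↑(box 3 (2 * m)) x y} := hms.trans_le hu
    refine (density_le hmn hupos).trans (ENNReal.ofReal_le_ofReal ?_)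
    -- real arithmetic: `1 / (u (2m+1)²) ≤ m^t / (2m+1)² ≤ 4 n^t / n² ≤ (4 + N₁²) n^{t-2}`
    have hc : ((n : ℝ) / 2) ^ 2 ≤ ((2 * m + 1 : ℕ) : ℝ) ^ 2 := by
      have : (n : ℝ) / 2 ≤ ((2 * m + 1 : ℕ) : ℝ) := by
        rw [div_le_iff₀ (by norm_num : (0 : ℝ) < 2)]
        have : (n : ℝ) ≤ 2 * m + 2 := by exact_mod_cast hnm
        push_cast
        linarith
      exact pow_le_pow_left₀ (by positivity) this 2
    have hcpos : (0 : ℝ) < ((2 * m + 1 : ℕ) : ℝ) ^ 2 := by positivity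
    have hms' : (m : ℝ) ^ t ≤ (n : ℝ) ^ t :=
      Real.rpow_le_rpow hmpos.le (by exact_mod_cast (by omega : m ≤ n)) ht.le
    calc 1 / ((bondPercolation (zdGraph 3) (criticalProbI 3)).real
            {ω | ¬ ∃ x ∈ box 3 m, ∃ y ∈ innerBoundary (zdGraph 3) (box 3 (2 * m)),
              ω ∈ openConnIn ↑(box 3 (2 * m)) x y} * ((2 * m + 1 : ℕ) : ℝ) ^ 2)
        ≤ 1 / ((m : ℝ) ^ (-t) * ((2 * m + 1 : ℕ) : ℝ) ^ 2) :=
          one_div_le_one_div_of_le (mul_pos hms hcpos) (mul_le_mul_of_nonneg_right hu hcpos.le)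
      _ = (m : ℝ) ^ t / ((2 * m + 1 : ℕ) : ℝ) ^ 2 := by
          rw [Real.rpow_neg hmpos.le, one_div, mul_inv, inv_inv, div_eq_mul_inv]
      _ ≤ (n : ℝ) ^ t / ((n : ℝ) / 2) ^ 2 := by
          gcongr
      _ = 4 * ((n : ℝ) ^ t / (n : ℝ) ^ 2) := by
          field_simp
          ring
      _ ≤ (4 + (N₁ : ℝ) ^ 2) * (n : ℝ) ^ (t - 2) := by
          rw [hsplit]
          have : (0 : ℝ) ≤ (n : ℝ) ^ t / (n : ℝ) ^ 2 := by positivity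
          nlinarith [sq_nonneg (N₁ : ℝ)]

end StubTallDensity

namespace StubDirectStep

open Negative (μ)
open StubStep (kissV partnerKiss exactDens tallDens kissV_antitone_level sum_exactDens_toReal_le even_bound
  decay_of_eventually)

/-- **The direct step at a FIXED multiplicity loss `c` and a FIXED tall-density exponent `t`.** From the census, the tall
density AT `t` (`ν_n ≤ C_t n^{t-2}`, `n ≥ 1`) and `KTailAt c` (eventually `n^{-c} P(A_n) ≤ P(A_n ∧ K_n ≤ ⌈n^c⌉)`, `c ≥ 0`):
`AprioriV (3 - 2c - t)`. -/
theorem aprioriV_of_kTailAt_at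
    (hCensus : ∃ C : ℝ, ∀ n k : ℕ, 1 ≤ n → 1 ≤ k →
      μ.real (kissV n 0 1 ∩ {ω | (partnerKiss n ω).ncard ≤ k}) ≤ C * (k : ℝ) * (exactDens n).toReal)
    {t : ℝ} (hTall : ∃ C : ℝ, ∀ n : ℕ, 1 ≤ n → tallDens n ≤ ENNReal.ofReal (C * (n : ℝ) ^ (t - 2)))
    {c : ℝ} (hc : 0 ≤ c)
    (hK : ∀ᶠ n : ℕ in Filter.atTop,
      (n : ℝ) ^ (-c) * μ.real (kissV n 0 1) ≤
        μ.real (kissV n 0 1 ∩ {ω | (partnerKiss n ω).ncard ≤ ⌈(n : ℝ) ^ c⌉₊})) :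
    ∃ C : ℝ, ∀ n : ℕ, 1 ≤ n → μ.real (kissV n 0 1) ≤ C * (n : ℝ) ^ (-(3 - (c + c) - t)) := by
  obtain ⟨C₁, hC₁⟩ := hCensus
  obtain ⟨Ct, hCt⟩ := hTall
  obtain ⟨N₀, hN₀⟩ := Filter.eventually_atTop.1 hK
  have hγ0 : 0 ≤ c + c := add_nonneg hc hc
  have hC₂0 : (0 : ℝ) ≤ 2 * max C₁ 0 := mul_nonneg zero_le_two (le_max_right _ _)
  have hstep : ∀ n : ℕ, max N₀ 1 ≤ n →
      μ.real (kissV n 0 1) ≤ 2 * max C₁ 0 * (n : ℝ) ^ (c + c) * (exactDens n).toReal :=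
    fun n hn => pointwise (le_of_max_le_right hn) hc (fun k hk => hC₁ n k (le_of_max_le_right hn) hk)
      (hN₀ n (le_of_max_le_left hn))
  have hanti : ∀ m m' : ℕ, m ≤ m' → μ.real (kissV m' 0 1) ≤ μ.real (kissV m 0 1) :=
    fun m m' h => measureReal_mono (kissV_antitone_level h 0 1)
  have hsum : ∀ N : ℕ, 1 ≤ N →
      ∑ m ∈ Finset.Icc N (2 * N), (exactDens m).toReal ≤ max Ct 0 * (N : ℝ) ^ (t - 2) :=
    fun N hN => sum_exactDens_toReal_le (hCt N hN)
  have heven : ∀ N : ℕ, max N₀ 1 ≤ N →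
      μ.real (kissV (2 * N) 0 1) ≤ 2 * max C₁ 0 * (2 : ℝ) ^ (c + c) * max Ct 0 * (N : ℝ) ^ (-(3 - (c + c) - t)) := by
    intro N hN
    have hN1 : 1 ≤ N := le_of_max_le_right hN
    have h := even_bound (f := fun m => μ.real (kissV m 0 1)) (e := fun m => (exactDens m).toReal)
      hγ0 hC₂0 (le_max_right Ct 0) (fun _ => ENNReal.toReal_nonneg) hanti hstep (hsum N hN1) hN hN1
    have hexp : c + c + t - 3 = -(3 - (c + c) - t) := by ring
    rw [hexp] at h
    exact h
  exact decay_of_eventually (f := fun m => μ.real (kissV m 0 1)) (le_max_right N₀ 1)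
    (fun _ => measureReal_le_one) hanti heven

end StubDirectStep

open StubDirectStep StubStep Negative in
/-- **Fully parametric conditional reduction of crux A** (registered sub-goal `stub_kTailAtBlockingAtReduction` of
stmt-CriticalPhenomena-0911, line `staircase-bootstrap-floor-decoupling`, lead c1): for `0 < c`, `0 < t`, `1 ≤ A` with
`5A + 4c + 2t < 6`, the multiplicity input at the fixed loss `c` (eventually `n^{-c} P(A_n) ≤ P(A_n ∧ K_n ≤ ⌈n^c⌉)`), annulus
blocking at the fixed rate `t` (eventually `n^{-t} ≤ u_n`, ONE exponent of stmt-4446) and a polynomial slab crossover with exponent `A`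
(the body of stmt-6700 at `A`) imply `BoundaryTwoArmDecay`.  Proof: `StubTallDensity.density_bound_of_blockingAt`,
`StubDirectStep.aprioriV_of_kTailAt_at` (vertical exponent `3 - 2c - t`), then the landed `stub_reach` with `δ = 6 - 5A - 4c - 2t`,
`b = 5/2 + δ/4` (`b·A < 3 - 2c - t ⟺ A < 2`), `κ = δ/4`. -/
theorem stub_kTailAtBlockingAtReduction :
    ∀ c t A : ℝ, 0 < c → 0 < t → 1 ≤ A → 5 * A + 4 * c + 2 * t < 6 →
    (∀ᶠ n : ℕ in Filter.atTop,
      (n : ℝ) ^ (-c) *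
          (bondPercolation (zdGraph 3) (criticalProbI 3)).real
            {ω | (∃ y : Site 3, (n : ℤ) ≤ y 0 ∧ ω ∈ openConnIn (halfSpace 3) 0 y) ∧
              (∃ y : Site 3, (n : ℤ) ≤ y 0 ∧ ω ∈ openConnIn (halfSpace 3) ((0 : Site 3) + Pi.single 1 1) y) ∧
              ω ∉ openConnIn (halfSpace 3) 0 ((0 : Site 3) + Pi.single 1 1)} ≤
        (bondPercolation (zdGraph 3) (criticalProbI 3)).real
          ({ω | (∃ y : Site 3, (n : ℤ) ≤ y 0 ∧ ω ∈ openConnIn (halfSpace 3) 0 y) ∧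
              (∃ y : Site 3, (n : ℤ) ≤ y 0 ∧ ω ∈ openConnIn (halfSpace 3) ((0 : Site 3) + Pi.single 1 1) y) ∧
              ω ∉ openConnIn (halfSpace 3) 0 ((0 : Site 3) + Pi.single 1 1)} ∩
            {ω | {q : Site 3 × Site 3 | q.1 0 = 0 ∧ q.2 0 = 0 ∧ (zdGraph 3).Adj q.1 q.2 ∧
                ω ∈ openConnIn (halfSpace 3) 0 q.1 ∧ ω ∉ openConnIn (halfSpace 3) 0 q.2 ∧
                ∃ y : Site 3, (n : ℤ) ≤ y 0 ∧ ω ∈ openConnIn (halfSpace 3) q.2 y}.ncard ≤ ⌈(n : ℝ) ^ c⌉₊})) →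
    (∀ᶠ n : ℕ in Filter.atTop, (n : ℝ) ^ (-t) ≤ (bondPercolation (zdGraph 3) (criticalProbI 3)).real
      {ω | ¬ ∃ x ∈ box 3 n, ∃ y ∈ innerBoundary (zdGraph 3) (box 3 (2 * n)), ω ∈ openConnIn ↑(box 3 (2 * n)) x y}) →
    (∃ C : ℝ, 0 < C ∧ ∀ k n : ℕ, 1 ≤ k → ∀ x : Site 3,
      (bondPercolation (zdGraph 3) (criticalProbI 3)).real
          {ω | ∃ y : Site 3, (n : ℤ) ≤ max |y 1 - x 1| |y 2 - x 2| ∧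
            ω ∈ openConnIn {z : Site 3 | |z 0| ≤ (k : ℤ)} x y} ≤
        C * (k : ℝ) ^ C * Real.exp (-((n : ℝ) / (C * (k : ℝ) ^ A)))) →
      Summit.CriticalPhenomena.PercolationContinuityZ3.Theses.PercLowPointHalfSpace.BoundaryTwoArmDecay := by
  intro c t A hc ht hA1 hctA hK hBt hSlab
  -- the margin δ = 6 - 5A - 4c - 2t > 0
  set δ : ℝ := 6 - 5 * A - 4 * c - 2 * t with hδdef
  have hδ : 0 < δ := by rw [hδdef]; linarith
  have hA2 : A < 2 := by linarith
  -- tall density at the one exponent t, then the direct step: vertical exponent 3 - 2c - t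
  have hTall := StubTallDensity.density_bound_of_blockingAt ht hBt
  have hV : ∃ C : ℝ, ∀ n : ℕ, 1 ≤ n → μ.real (kissV n 0 1) ≤ C * (n : ℝ) ^ (-(3 - (c + c) - t)) :=
    aprioriV_of_kTailAt_at stub_census hTall hc.le hK
  -- reach: sup exponent b = 5/2 + δ/4, admissible since bA < 3 - 2c - t ⟺ A < 2
  set b : ℝ := 5 / 2 + δ / 4 with hbdef
  have hb : 0 < b := by rw [hbdef]; linarith
  have hbA : b * A < 3 - (c + c) - t := by
    rw [hbdef]
    have h5A : 5 / 2 * A = 3 - 2 * c - t - δ / 2 := by rw [hδdef]; ring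
    nlinarith [mul_pos hδ (sub_pos.2 hA2)]
  obtain ⟨C, hC⟩ := stub_reach A hA1 hSlab (3 - (c + c) - t) b hb hbA hV
  -- κ = δ/4
  rw [boundaryTwoArmDecay_iff]
  refine ⟨δ / 4, C, by positivity, fun r hr => ?_⟩
  have hexp : (-(5 / 2 + δ / 4) : ℝ) = -b := by rw [hbdef]
  rw [hexp]
  exact hC r hr

end Summit.CriticalPhenomena.PercolationContinuityZ3.Theorems.BoundaryTwoArmDecay

end
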